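import Mathlib.Probability.Moments.SubGaussian
import Mathlib.Probability.Moments.Tilted
import HarnessLib

/-!
# The Jensen gap is half a path variance: `log ∫ e^{h} dP − ∫ h dP = ½ · Var_{P_u}(h)` for some `u ∈ (0,1)`

Topic `Literature/Probability/Divergences`; namespace `Literature.Probability.Divergences`.  Sequel of `TiltedPathEventBound.lean` (whose
bound `P_t(A) ≤ P₀(A)^{1−t} P₁(A)^t · exp(t·J₀)` carries the JENSEN GAP `J₀ := log ∫ e^{h} dP − ∫ h dP` of the tilt `h` under the base law).  Everything
here is PROVED (Taylor–Lagrange for the cumulant generating function, Mathlib's Hoeffding-lemma machinery); no definitions, no named facts.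

For a probability law `P` and an a.s. BOUNDED real `h` (`h ∈ [a,b]` a.s. — used to differentiate the cgf; no bound below depends on `a, b` except
Hoeffding's), with `P_u := P.tilted (u·h)` the exponential path of `TiltedPathEventBound`:

* `tilted_mul_sub_const` — centring the tilt does not move the law: `P.tilted (u·(h − c)) = P.tilted (u·h)`;
* `cgf_sub_integral_one` — `cgf (h − ∫h dP) P 1 = log ∫ e^{h} dP − ∫ h dP`;
* ★`exists_jensenGap_eq_half_variance_tilted` — **`∃ u ∈ (0,1), log ∫ e^{h} dP − ∫ h dP = Var[h; P_u] ∕ 2`** (Taylor–Lagrange at order 2 for the cgf of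
  the centred variable — Mathlib `exists_cgf_eq_iteratedDeriv_two_cgf_mul`; `cgf″(u) = Var[·; P_u]` — `variance_tilted_mul`; centring moves neither the
  tilted law nor the variance — `variance_sub_const`);
* `jensenGap_le_half_of_variance_tilted_le` — letter form: `(∀ u ∈ (0,1), Var[h; P_u] ≤ σ²) → log ∫ e^{h} dP − ∫ h dP ≤ σ² ∕ 2`;
* `jensenGap_nonneg` — `0 ≤ log ∫ e^{h} dP − ∫ h dP`;
* `jensenGap_le_sq_div_eight` — Hoeffding's lemma form: `log ∫ e^{h} dP − ∫ h dP ≤ (b − a)² ∕ 8` (`variance_le_sq_of_bounded` along the path);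
* `weighted_jensenGap_nonneg_and_le` — the un-normalised edition (`0 ≤ gap ≤ σ²∕2`) for a weight `w ≥ 0` on any measure space (base law `w dμ ∕ ∫w`, path
  `w e^{uh} dμ`, variance displayed as a quotient of `w dμ`-integrals) — the shape met by interpolated densities `w·e^{u h}`.

Use (crux 20520, DISCHARGE-SPEC (xv-b)): the `J`-letter of `…OrganTangentGoodSetTailAlongPath.setIntegral_wgt_le_max_mul_exp` becomes «half the largest
variance of `h = log ρ_Ts − log ρ′_Ts` along the interpolated fibre laws `ŵ_u`» — connected-correlation currency — with no sup-norm of `h` in the bound.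

[cite: BoucheronLugosiMassart2013, Lemma 2.2 p. 27 (Hoeffding's lemma via ψ″ = tilted variance)] [cite: Hoeffding1963, (4.16) p. 22] [cite: Rudin1987, Thm 3.3 p. 62]
-/

noncomputable section

open MeasureTheory ProbabilityTheory Set
open scoped ENNReal

namespace Literature.Probability.Divergences

variable {Ω : Type*} [MeasurableSpace Ω]

/-! ## §1 Centring and the path -/

/-- Centring the tilt does not move the tilted law: `P.tilted (u·(h − c)) = P.tilted (u·h)` (`P` a probability law, `e^{u h} ∈ L¹(P)`).
[cite: BoucheronLugosiMassart2013, Lemma 2.2 p. 27] -/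
theorem tilted_mul_sub_const (P : Measure Ω) [IsProbabilityMeasure P] {h : Ω → ℝ} {u : ℝ} (c : ℝ)
    (hu : Integrable (fun ω => Real.exp (u * h ω)) P) :
    P.tilted (fun ω => u * (h ω - c)) = P.tilted (fun ω => u * h ω) := by
  haveI : IsProbabilityMeasure (P.tilted (fun ω => u * h ω)) := isProbabilityMeasure_tilted hu
  have e : (fun ω => u * (h ω - c)) = (fun ω => u * h ω) + fun _ => -(u * c) := by
    funext ω; simp only [Pi.add_apply]; ring
  rw [e, ← tilted_tilted hu, tilted_const]

/-- The cgf of the centred variable at `1` is the Jensen gap: `cgf (h − ∫h dP) P 1 = log ∫ e^{h} dP − ∫ h dP` (`e^{h} ∈ L¹(P)`).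
[cite: BoucheronLugosiMassart2013, Lemma 2.2 p. 27] -/
theorem cgf_sub_integral_one (P : Measure Ω) [IsProbabilityMeasure P] {h : Ω → ℝ} (heh : Integrable (fun ω => Real.exp (h ω)) P) :
    cgf (fun ω => h ω - ∫ x, h x ∂P) P 1 = Real.log (∫ ω, Real.exp (h ω) ∂P) - ∫ ω, h ω ∂P := by
  have e : (fun ω => Real.exp (1 * (h ω - ∫ x, h x ∂P))) = fun ω => Real.exp (-(∫ x, h x ∂P)) * Real.exp (h ω) := by
    funext ω; rw [one_mul, sub_eq_neg_add, Real.exp_add]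
  rw [cgf, mgf, e, integral_const_mul, Real.log_mul (Real.exp_pos _).ne' (integral_exp_pos heh).ne', Real.log_exp]
  ring

/-! ## §2 The Jensen gap as half a path variance -/

/-- ★ **THE JENSEN GAP IS HALF A PATH VARIANCE** — `P` a probability law, `h ∈ [a,b]` a.s.:
`∃ u ∈ (0,1), log ∫ e^{h} dP − ∫ h dP = Var[h; P.tilted (u·h)] ∕ 2` (Taylor–Lagrange at order 2 for the cgf of `h − ∫h dP`, whose second derivative at `u` is the
variance under the tilted law). [cite: BoucheronLugosiMassart2013, Lemma 2.2 p. 27] -/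
theorem exists_jensenGap_eq_half_variance_tilted (P : Measure Ω) [IsProbabilityMeasure P] {h : Ω → ℝ} {a b : ℝ}
    (hm : AEMeasurable h P) (hb : ∀ᵐ ω ∂P, h ω ∈ Icc a b) :
    ∃ u ∈ Ioo (0 : ℝ) 1, Real.log (∫ ω, Real.exp (h ω) ∂P) - ∫ ω, h ω ∂P = variance h (P.tilted (fun ω => u * h ω)) / 2 := by
  set c : ℝ := ∫ ω, h ω ∂P with hc
  set X : Ω → ℝ := fun ω => h ω - c with hX
  have hhi : Integrable h P := Integrable.of_mem_Icc a b hm hb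
  have hXm : AEMeasurable X P := hm.sub_const c
  have hXb : ∀ᵐ ω ∂P, X ω ∈ Icc (a - c) (b - c) :=
    hb.mono fun ω hω => ⟨sub_le_sub_right hω.1 c, sub_le_sub_right hω.2 c⟩
  have hXc : ∫ ω, X ω ∂P = 0 := by
    simp only [hX]
    rw [integral_sub hhi (integrable_const c), integral_const, smul_eq_mul, probReal_univ, one_mul, hc, sub_self]
  have hi : ∀ u : ℝ, Integrable (fun ω => Real.exp (u * X ω)) P :=
    fun u => ProbabilityTheory.integrable_exp_mul_of_mem_Icc hXm hXb
  have hih : ∀ u : ℝ, Integrable (fun ω => Real.exp (u * h ω)) P :=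
    fun u => ProbabilityTheory.integrable_exp_mul_of_mem_Icc hm hb
  have hs : Icc (0 : ℝ) 1 ⊆ interior (integrableExpSet X P) := by
    have huniv : integrableExpSet X P = univ := by
      ext u; simp only [integrableExpSet, mem_setOf_eq, mem_univ, iff_true]; exact hi u
    rw [huniv, interior_univ]; exact subset_univ _
  obtain ⟨u, hu, h2⟩ := exists_cgf_eq_iteratedDeriv_two_cgf_mul one_pos hXc hs
  refine ⟨u, hu, ?_⟩
  have heh : Integrable (fun ω => Real.exp (h ω)) P := by simpa only [one_mul] using hih 1
  rw [← variance_tilted_mul (hs (mem_Icc_of_Ioo hu)), one_pow, mul_one, hX, cgf_sub_integral_one P heh,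
    tilted_mul_sub_const P c (hih u)] at h2
  haveI : IsProbabilityMeasure (P.tilted (fun ω => u * h ω)) := isProbabilityMeasure_tilted (hih u)
  rw [variance_sub_const (hm.mono_ac (tilted_absolutelyContinuous P _)).aestronglyMeasurable] at h2
  exact h2

/-- **Letter form** — if the variance of `h` along the path is at most `σ²` (`∀ u ∈ (0,1), Var[h; P.tilted (u·h)] ≤ σ²`), then
`log ∫ e^{h} dP − ∫ h dP ≤ σ² ∕ 2`. [cite: BoucheronLugosiMassart2013, Lemma 2.2 p. 27] -/
theorem jensenGap_le_half_of_variance_tilted_le (P : Measure Ω) [IsProbabilityMeasure P] {h : Ω → ℝ} {a b : ℝ}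
    (hm : AEMeasurable h P) (hb : ∀ᵐ ω ∂P, h ω ∈ Icc a b) {σ2 : ℝ}
    (hvar : ∀ u ∈ Ioo (0 : ℝ) 1, variance h (P.tilted (fun ω => u * h ω)) ≤ σ2) :
    Real.log (∫ ω, Real.exp (h ω) ∂P) - ∫ ω, h ω ∂P ≤ σ2 / 2 := by
  obtain ⟨u, hu, he⟩ := exists_jensenGap_eq_half_variance_tilted P hm hb
  rw [he]
  exact div_le_div_of_nonneg_right (hvar u hu) (by norm_num)

/-- **Non-negativity of the Jensen gap** — `0 ≤ log ∫ e^{h} dP − ∫ h dP` for `h ∈ [a,b]` a.s. (a variance is `≥ 0`). [cite: Rudin1987, Thm 3.3 p. 62] -/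
theorem jensenGap_nonneg (P : Measure Ω) [IsProbabilityMeasure P] {h : Ω → ℝ} {a b : ℝ}
    (hm : AEMeasurable h P) (hb : ∀ᵐ ω ∂P, h ω ∈ Icc a b) :
    0 ≤ Real.log (∫ ω, Real.exp (h ω) ∂P) - ∫ ω, h ω ∂P := by
  obtain ⟨u, -, he⟩ := exists_jensenGap_eq_half_variance_tilted P hm hb
  rw [he]
  exact div_nonneg (variance_nonneg _ _) (by norm_num)

/-- **Hoeffding's lemma form** — `h ∈ [a,b]` a.s. ⟹ `log ∫ e^{h} dP − ∫ h dP ≤ (b − a)² ∕ 8` (the path variance is `≤ ((b−a)∕2)²`, the tilted laws being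
absolutely continuous w.r.t. `P`). [cite: Hoeffding1963, (4.16) p. 22] [cite: BoucheronLugosiMassart2013, Lemma 2.2 p. 27] -/
theorem jensenGap_le_sq_div_eight (P : Measure Ω) [IsProbabilityMeasure P] {h : Ω → ℝ} {a b : ℝ}
    (hm : AEMeasurable h P) (hb : ∀ᵐ ω ∂P, h ω ∈ Icc a b) :
    Real.log (∫ ω, Real.exp (h ω) ∂P) - ∫ ω, h ω ∂P ≤ (b - a) ^ 2 / 8 := by
  have hvar : ∀ u ∈ Ioo (0 : ℝ) 1, variance h (P.tilted (fun ω => u * h ω)) ≤ ((b - a) / 2) ^ 2 := by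
    intro u _
    haveI : IsProbabilityMeasure (P.tilted (fun ω => u * h ω)) :=
      isProbabilityMeasure_tilted (ProbabilityTheory.integrable_exp_mul_of_mem_Icc hm hb)
    exact variance_le_sq_of_bounded ((tilted_absolutelyContinuous P _) hb) (hm.mono_ac (tilted_absolutelyContinuous P _))
  have h1 := jensenGap_le_half_of_variance_tilted_le P hm hb hvar
  calc Real.log (∫ ω, Real.exp (h ω) ∂P) - ∫ ω, h ω ∂P ≤ ((b - a) / 2) ^ 2 / 2 := h1
    _ = (b - a) ^ 2 / 8 := by ring

/-! ## §3 Weighted edition (un-normalised base weight `w dμ`; the path `w·e^{u h} dμ`) -/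

/-- **Weighted edition** — `μ` any measure, `w ≥ 0` a measurable weight with `∫ w dμ > 0`, `w` integrable, `h` measurable and bounded on the support of `w`
(`w ≠ 0 ⟹ h ∈ [a,b]` a.e.).  If along the path `w·e^{u h} dμ` (`u ∈ (0,1)`) the VARIANCE of `h` — displayed as `(∫ w e^{uh}(h − m_u)²) ∕ ∫ w e^{uh}` with
`m_u = (∫ w e^{uh} h) ∕ ∫ w e^{uh}` — is at most `σ²`, then the Jensen gap of the base law obeys
`0 ≤ log((∫ w e^{h}) ∕ ∫ w) − (∫ w h) ∕ ∫ w ≤ σ² ∕ 2` (both halves: `jensenGap_nonneg` and `jensenGap_le_half_of_variance_tilted_le`) (= `jensenGap_le_half_of_variance_tilted_le` for the probability law `w dμ ∕ ∫w`, whose `u·h`-tilt is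
`w e^{uh} dμ ∕ ∫ w e^{uh}`).  This is the shape met by the interpolated fibre weights `wNum_u = wNum₀·e^{u h}`. [cite: BoucheronLugosiMassart2013, Lemma 2.2 p. 27] -/
theorem weighted_jensenGap_nonneg_and_le (μ : Measure Ω) {w : Ω → NNReal} (hw : Measurable w) {h : Ω → ℝ} (hm : Measurable h)
    {a b : ℝ} (hb : ∀ᵐ ω ∂μ, w ω ≠ 0 → h ω ∈ Icc a b)
    (hwi : Integrable (fun ω => (w ω : ℝ)) μ) (hpos : 0 < ∫ ω, (w ω : ℝ) ∂μ) {σ2 : ℝ}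
    (hvar : ∀ u ∈ Ioo (0 : ℝ) 1,
      (∫ ω, (w ω : ℝ) * Real.exp (u * h ω) *
          (h ω - (∫ x, (w x : ℝ) * Real.exp (u * h x) * h x ∂μ) / ∫ x, (w x : ℝ) * Real.exp (u * h x) ∂μ) ^ 2 ∂μ)
        / (∫ ω, (w ω : ℝ) * Real.exp (u * h ω) ∂μ) ≤ σ2) :
    0 ≤ Real.log ((∫ ω, (w ω : ℝ) * Real.exp (h ω) ∂μ) / ∫ ω, (w ω : ℝ) ∂μ) - (∫ ω, (w ω : ℝ) * h ω ∂μ) / ∫ ω, (w ω : ℝ) ∂μ ∧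
    Real.log ((∫ ω, (w ω : ℝ) * Real.exp (h ω) ∂μ) / ∫ ω, (w ω : ℝ) ∂μ) - (∫ ω, (w ω : ℝ) * h ω ∂μ) / ∫ ω, (w ω : ℝ) ∂μ ≤ σ2 / 2 := by
  set c : ℝ := ∫ ω, (w ω : ℝ) ∂μ with hc
  have hc0 : c ≠ 0 := hpos.ne'
  have hcE : ENNReal.ofReal c ≠ 0 := fun h0 => (not_le.2 hpos) (ENNReal.ofReal_eq_zero.1 h0)
  set ν : Measure Ω := μ.withDensity (fun ω => (w ω : ℝ≥0∞)) with hν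
  have hνuniv : ν univ = ENNReal.ofReal c := by
    rw [hν, withDensity_apply _ MeasurableSet.univ, Measure.restrict_univ, hc,
      ofReal_integral_eq_lintegral_ofReal hwi (Filter.Eventually.of_forall fun ω => (w ω).coe_nonneg)]
    refine lintegral_congr_ae (Filter.Eventually.of_forall fun ω => ?_)
    simp only [ENNReal.ofReal_coe_nnreal]
  set P : Measure Ω := (ENNReal.ofReal c)⁻¹ • ν with hP
  haveI : IsProbabilityMeasure P :=
    ⟨by rw [hP, Measure.smul_apply, hνuniv, smul_eq_mul, ENNReal.inv_mul_cancel hcE ENNReal.ofReal_ne_top]⟩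
  -- dictionary `P ↔ w dμ`
  have hint : ∀ g : Ω → ℝ, ∫ ω, g ω ∂P = c⁻¹ * ∫ ω, (w ω : ℝ) * g ω ∂μ := by
    intro g
    rw [hP, integral_smul_measure, hν, integral_withDensity_eq_integral_smul hw, ENNReal.toReal_inv,
      ENNReal.toReal_ofReal hpos.le, smul_eq_mul]
    rfl
  -- `h` is a.s. bounded under `P`
  have hbν : ∀ᵐ ω ∂ν, h ω ∈ Icc a b := by
    rw [hν, ae_withDensity_iff hw.coe_nnreal_ennreal]
    filter_upwards [hb] with ω hω hne
    exact hω (by exact_mod_cast hne)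
  have hbP : ∀ᵐ ω ∂P, h ω ∈ Icc a b := by rw [hP]; exact Measure.ae_smul_measure hbν _
  have hmP : AEMeasurable h P := hm.aemeasurable
  -- the tilted laws of `P` along `u·h` in `w dμ` letters
  have htilt : ∀ (u : ℝ) (g : Ω → ℝ), ∫ ω, g ω ∂(P.tilted fun ω => u * h ω)
      = (∫ ω, (w ω : ℝ) * Real.exp (u * h ω) * g ω ∂μ) / ∫ ω, (w ω : ℝ) * Real.exp (u * h ω) ∂μ := by
    intro u g
    rw [integral_tilted, hint]
    have hZ : ∫ x, Real.exp (u * h x) ∂P = c⁻¹ * ∫ x, (w x : ℝ) * Real.exp (u * h x) ∂μ := hint _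
    rw [hZ]
    have e : (fun ω => (w ω : ℝ) * ((Real.exp (u * h ω) / (c⁻¹ * ∫ x, (w x : ℝ) * Real.exp (u * h x) ∂μ)) • g ω))
        = fun ω => (c⁻¹ * ∫ x, (w x : ℝ) * Real.exp (u * h x) ∂μ)⁻¹ * ((w ω : ℝ) * Real.exp (u * h ω) * g ω) := by
      funext ω; simp only [smul_eq_mul]; ring
    rw [e, integral_const_mul, mul_inv, inv_inv]
    field_simp
  -- variance along the path = the displayed quotient
  have hvarP : ∀ u ∈ Ioo (0 : ℝ) 1, variance h (P.tilted fun ω => u * h ω) ≤ σ2 := by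
    intro u hu
    haveI : IsProbabilityMeasure (P.tilted fun ω => u * h ω) :=
      isProbabilityMeasure_tilted (ProbabilityTheory.integrable_exp_mul_of_mem_Icc hmP hbP)
    rw [variance_eq_integral hm.aemeasurable, htilt u, htilt u]
    exact hvar u hu
  have hmain := jensenGap_le_half_of_variance_tilted_le P hmP hbP hvarP
  have hnn := jensenGap_nonneg P hmP hbP
  rw [hint, hint, inv_mul_eq_div, inv_mul_eq_div] at hmain hnn
  exact ⟨hnn, hmain⟩

end Literature.Probability.Divergences

end
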